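import Mathlib
import Summits.MatrixMultiplication.Statement

/-!
# Graph equations — THE DEFLATION TOWER, I: its local algebra (M22a, decomp-mm-lens-5 g35)

(supports `MultiplicityReduction`, stmt-MatrixMultiplication-27806.  No new definition.)

**The theorem this engine serves** (NODE-g35, memo-proved and checked exactly on seven `n = 2` families):
if `t₁,…,t_T ∈ I(W_n)` lie in the free span of a nonscalar sequence of length `N` and `f_q^m ∈ (t)·R_I`
for every `q` (`R_I` = the local ring of `ℂ[a,b,c]` at the prime `I` of the graph; this is the
hypothesis of the rung `FR(m)` of `GraphEquationsGapDial`), then `R(⟨n,n,n⟩) ≤ 2·3^{m-1}·N` — EVERY rung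
of the membership ladder, not only `m ≤ 2`.  The supplier is the Leykin–Verschelde–Zhao deflation
tower run over the GENERIC point `Spec ℂ(a,b) → W` with the kernel directions kept as VARIABLES
`λ^{(1)}, …, λ^{(m-1)}` to the end (their Jacobian columns are what cancel the second-order twist that
stopped the substituted-field engines of g32/g33 at gap `2`), read in Ostrowski's model (each stage is a
tangent program, cost `× 3`; the new variables become cost-free affine inputs) by the serve engine
`tensorRank_le_of_abServed` (M20b).

**This module: the commutative algebra that makes the tower stop after `m - 1` stages** — the step
count is governed by the COORDINATE EXPONENT `m`, not by the multiplicity (LVZ, Thm. 3.1) or the depth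
(Dayton–Zeng, Thm. 3) of the fat point `R_I/(t)R_I`:

* `pow_pred_mem_of_derivation` — EXPONENT DROP: ideals `J → J'` linked by a derivation `D`
  (`D J ⊆ J'`), `x^e ∈ J`, `D x` a unit modulo `J'`, `e` a unit modulo `J'` ⇒ `x^{e-1} ∈ J'`.
  (In the tower: `J = G_j O`, `J' = G_{j+1} O`, `D = D_j = Σ_x (B_j λ^{(j+1)})_x ∂_x`,
  `D F_q = (B_j λ^{(j+1)})_{F_q}`, a unit at the deflated point for every FREE coordinate `q`.)
* `pow_sub_mem_of_tower`, `mem_of_tower` — its iterate along a chain `J 0 → J 1 → ⋯`: `x^m ∈ J 0` and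
  admissible drops at stages `0,…,m-2` ⇒ `x ∈ J (m-1)`;  `isUnit_quotientMk_natCast` — over a field of
  characteristic `0` the invertibility of `e` is automatic.
* `sub_mem_of_leftInverse` — SLAVING of the kernel variables: if `E₀` has a left inverse, `E ≡ E₀`
  modulo `P` entrywise, `E₀ λ⋆ = e` and `E λ ≡ e` modulo `G`, then `λ - λ⋆ ∈ G ⊔ P` componentwise
  (in the tower: `E = [A_j(X_j) B_j ; h_j]`, `P = 𝔪_{P_j}`, so `μ^{(j+1)} ∈ 𝔪_j Ō_{j+1}`).
* `ideal_le_of_le_sup_mul_self` (Nakayama: `P` f.g., `P ≤ jacobson ⊥`, `P ≤ G ⊔ P·P` ⇒ `P ≤ G`), its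
  local-ring form, and `tower_terminates` — THE FINISH: if the point ideal `P` is generated by free
  coordinates (in `G`), forced coordinates (in `G ⊔ P²`) and slaved kernel variables
  (`μ_i ∈ G ⊔ (coordinates, μ_{<i})`), then `P ≤ G`: the deflated system generates the maximal ideal,
  i.e. it is REGULAR at the deflated generic point, and its Jacobian in `(F, Λ)` has full column rank —
  the input of the rank reading.

What is NOT here (successor targets, all classical): the `ℂ`-genericity of the constants `B_j, h_j`
over `ℂ(a,b)`; the jet-serve coefficient identity turning `P·[∂_c τ | ∂_Λ τ] = [I | 0]` plus vanishing
along the kernel section into `hserve`; the word expansion of the deflated generators after the affine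
substitution `Λ := ℓ(u,v)`.  No `sorry`.
Sources: Leykin–Verschelde–Zhao, Theoret. Comput. Sci. 359 (2006) 111–122, Thm. 3.1; Dayton–Zeng,
ISSAC 2005, Thm. 3 (both as cited in [galaxy:pdf:-8218814998499962200, p. 84] and
[corpus:boulier2022, p. 389, 402–403]); Bürgisser–Clausen–Shokrollahi (1997) (7.1), (7.7), (14.8);
[Stacks 00DV] (Mathlib `Submodule.le_of_le_smul_of_le_jacobson_bot`).
-/

set_option linter.dupNamespace false

namespace Summit.MatrixMultiplication.MatrixMultiplication.Theorems.GraphEquations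

open Ideal

/-! ## Exponent drop under a derivation -/

section ExponentDrop

variable {S R : Type*} [CommRing S] [CommRing R] [Algebra S R]

/-- **EXPONENT DROP (Lemma 1 of the tower).**  `D` a derivation with `D J ⊆ J'`, `x ^ e ∈ J`, `D x` a
unit modulo `J'` and `e` a unit modulo `J'`: then `x ^ (e - 1) ∈ J'`.  (`D (x^e) = e·x^{e-1}·D x`.) -/
theorem pow_pred_mem_of_derivation (D : Derivation S R R) {J J' : Ideal R}
    (hD : ∀ g ∈ J, D g ∈ J') {x : R} {e : ℕ} (hx : x ^ e ∈ J)
    (hunit : IsUnit (Ideal.Quotient.mk J' (D x)))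
    (he : IsUnit (Ideal.Quotient.mk J' (e : R))) : x ^ (e - 1) ∈ J' := by
  have h1 : D (x ^ e) ∈ J' := hD _ hx
  rw [D.leibniz_pow, nsmul_eq_mul, smul_eq_mul] at h1
  have h2 : Ideal.Quotient.mk J' ((e : R) * (x ^ (e - 1) * D x)) = 0 :=
    Ideal.Quotient.eq_zero_iff_mem.mpr h1
  rw [map_mul, map_mul] at h2
  exact Ideal.Quotient.eq_zero_iff_mem.mp
    ((hunit.mul_left_eq_zero).mp ((he.mul_right_eq_zero).mp h2))

/-- Over an algebra for a field of characteristic zero, `e ≥ 1` is a unit modulo every ideal. -/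
theorem isUnit_quotientMk_natCast {K : Type*} [Field K] [CharZero K] [Algebra K R] (J : Ideal R)
    {e : ℕ} (he : 1 ≤ e) : IsUnit (Ideal.Quotient.mk J (e : R)) := by
  have hK : IsUnit ((e : K)) := by
    rw [isUnit_iff_ne_zero]
    exact_mod_cast (show e ≠ 0 by omega)
  have hR : IsUnit ((e : R)) := by
    have := hK.map (algebraMap K R)
    rwa [map_natCast] at this
  exact hR.map _

/-- **THE ITERATED DROP.**  A chain of ideals `J 0, J 1, …` linked by derivations `D j` (`D j (J j) ⊆
J (j+1)`), `x ^ m ∈ J 0`, and `D j x` a unit modulo `J (j+1)` at every stage `j ≤ m - 2` (in the tower: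
the coordinate `x = F_q` is FREE at every stage, Lemma 2): then `x ^ (m - k) ∈ J k` for all `k ≤ m - 1`. -/
theorem pow_sub_mem_of_tower (J : ℕ → Ideal R) (D : ℕ → Derivation S R R)
    (hD : ∀ j, ∀ g ∈ J j, D j g ∈ J (j + 1)) {x : R} {m : ℕ} (hx : x ^ m ∈ J 0)
    (hunit : ∀ j, j + 1 < m → IsUnit (Ideal.Quotient.mk (J (j + 1)) (D j x)))
    (hchar : ∀ j (e : ℕ), 1 ≤ e → IsUnit (Ideal.Quotient.mk (J j) (e : R))) :
    ∀ k, k + 1 ≤ m → x ^ (m - k) ∈ J k := by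
  intro k
  induction k with
  | zero => intro _; simpa using hx
  | succ k ih =>
    intro hk
    have h := pow_pred_mem_of_derivation (D k) (hD k) (ih (by omega)) (hunit k (by omega))
      (hchar (k + 1) (m - k) (by omega))
    have hmk : m - (k + 1) = m - k - 1 := by omega
    rw [hmk]
    exact h

/-- **… in particular `x ∈ J (m - 1)`:** after `m - 1` deflation stages every free coordinate of
exponent `m` has exponent ONE. -/
theorem mem_of_tower (J : ℕ → Ideal R) (D : ℕ → Derivation S R R)
    (hD : ∀ j, ∀ g ∈ J j, D j g ∈ J (j + 1)) {x : R} {m : ℕ} (hm : 1 ≤ m) (hx : x ^ m ∈ J 0)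
    (hunit : ∀ j, j + 1 < m → IsUnit (Ideal.Quotient.mk (J (j + 1)) (D j x)))
    (hchar : ∀ j (e : ℕ), 1 ≤ e → IsUnit (Ideal.Quotient.mk (J j) (e : R))) :
    x ∈ J (m - 1) := by
  have h := pow_sub_mem_of_tower J D hD hx hunit hchar (m - 1) (by omega)
  have h1 : m - (m - 1) = 1 := by omega
  rwa [h1, pow_one] at h

end ExponentDrop

/-! ## Slaving of the kernel variables -/

section Slaving

variable {R : Type*} [CommRing R]

/-- **SLAVING (Lemma 3 of the tower).**  `Λ E₀ = 1` (left inverse), `E ≡ E₀ (mod P)` entrywise,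
`E₀ λ⋆ = e`, and the deflation equations `E λ ≡ e (mod G)`: then `λ - λ⋆ ∈ G ⊔ P` componentwise.
(`E₀ (λ - λ⋆) = (E λ - e) - (E - E₀) λ`, then apply `Λ`.) -/
theorem sub_mem_of_leftInverse {ι κ : Type*} [Fintype ι] [Fintype κ] [DecidableEq κ]
    (G P : Ideal R) (E E₀ : Matrix ι κ R) (Λ : Matrix κ ι R) (hΛ : Λ * E₀ = 1)
    (hE : ∀ i k, E i k - E₀ i k ∈ P) (lam lamStar : κ → R) (e : ι → R)
    (hstar : E₀.mulVec lamStar = e) (hsys : ∀ i, E.mulVec lam i - e i ∈ G) :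
    ∀ k, lam k - lamStar k ∈ G ⊔ P := by
  have hcomp : ∀ i, E₀.mulVec (lam - lamStar) i ∈ G ⊔ P := by
    intro i
    have hi : E₀.mulVec (lam - lamStar) i =
        (E.mulVec lam i - e i) - (E - E₀).mulVec lam i := by
      rw [Matrix.mulVec_sub, Matrix.sub_mulVec, ← hstar]
      simp only [Pi.sub_apply]
      ring
    rw [hi]
    refine Ideal.sub_mem _ (Ideal.mem_sup_left (hsys i)) (Ideal.mem_sup_right ?_)
    simp only [Matrix.mulVec, dotProduct, Matrix.sub_apply]
    exact Ideal.sum_mem _ fun k _ => Ideal.mul_mem_right _ _ (hE i k)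
  intro k
  have hk : (lam - lamStar) k = Λ.mulVec (E₀.mulVec (lam - lamStar)) k := by
    rw [Matrix.mulVec_mulVec, hΛ, Matrix.one_mulVec]
  rw [show lam k - lamStar k = (lam - lamStar) k from rfl, hk]
  simp only [Matrix.mulVec, dotProduct]
  exact Ideal.sum_mem _ fun i _ => Ideal.mul_mem_left _ _ (hcomp i)

end Slaving

/-! ## The finish: Nakayama -/

section Finish

variable {R : Type*} [CommRing R]

/-- **NAKAYAMA FINISH.**  `P` finitely generated, `P ≤ jacobson ⊥`, `P ≤ G ⊔ P·P` ⇒ `P ≤ G`. -/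
theorem ideal_le_of_le_sup_mul_self {P G : Ideal R} (hfg : P.FG) (hjac : P ≤ Ideal.jacobson ⊥)
    (h : P ≤ G ⊔ P * P) : P ≤ G :=
  Submodule.le_of_le_smul_of_le_jacobson_bot hfg hjac (by rwa [Ideal.smul_eq_mul])

/-- … in a LOCAL ring (the tower: `R = O_s`, `P = 𝔪_s O_s`, `G = G_s O_s`): `P ≠ ⊤` suffices. -/
theorem ideal_le_of_le_sup_mul_self_of_isLocalRing [IsLocalRing R] {P G : Ideal R} (hfg : P.FG)
    (hP : P ≠ ⊤) (h : P ≤ G ⊔ P * P) : P ≤ G :=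
  ideal_le_of_le_sup_mul_self hfg
    ((IsLocalRing.le_maximalIdeal hP).trans
      (IsLocalRing.jacobson_eq_maximalIdeal (⊥ : Ideal R) bot_ne_top).symm.le) h

/-- **THE TOWER TERMINATES (Lemma 5, abstract form).**  Let the point ideal
`P = (F_free, F_forced, μ_1, …, μ_k)` lie in the Jacobson radical (e.g. `R` local, `P ≠ ⊤`).  If the
free coordinates lie in `G` (exponent dropped to one: `mem_of_tower`), the forced coordinates lie in
`G ⊔ P·P` (their differentials are combinations of the generators'), and the kernel variables are
SLAVED in order (`μ_i ∈ G ⊔ (F, μ_{<i})`, `sub_mem_of_leftInverse`), then `P ≤ G`: the deflated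
system generates the point ideal, i.e. it is regular there. -/
theorem tower_terminates {G : Ideal R} (Ffree Fforced : Finset R) {k : ℕ} (mu : Fin k → R)
    (hjac : Ideal.span ((↑Ffree ∪ ↑Fforced) ∪ Set.range mu) ≤ Ideal.jacobson ⊥)
    (hfree : ∀ x ∈ Ffree, x ∈ G)
    (hforced : ∀ x ∈ Fforced, x ∈ G ⊔ Ideal.span ((↑Ffree ∪ ↑Fforced) ∪ Set.range mu) *
      Ideal.span ((↑Ffree ∪ ↑Fforced) ∪ Set.range mu))
    (hslave : ∀ i : Fin k,
      mu i ∈ G ⊔ Ideal.span ((↑Ffree ∪ ↑Fforced) ∪ {y | ∃ j : Fin k, j < i ∧ mu j = y})) :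
    Ideal.span ((↑Ffree ∪ ↑Fforced) ∪ Set.range mu) ≤ G := by
  set P : Ideal R := Ideal.span ((↑Ffree ∪ ↑Fforced) ∪ Set.range mu) with hPdef
  -- Step 1: every kernel variable lies in `G ⊔ (coordinates)`.
  have hmu : ∀ n : ℕ, ∀ i : Fin k, (i : ℕ) < n →
      mu i ∈ G ⊔ Ideal.span ((↑Ffree ∪ ↑Fforced : Set R)) := by
    intro n
    induction n with
    | zero => intro i hi; omega
    | succ n ih =>
      intro i hi
      have hle : Ideal.span ((↑Ffree ∪ ↑Fforced) ∪ {y | ∃ j : Fin k, j < i ∧ mu j = y}) ≤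
          G ⊔ Ideal.span ((↑Ffree ∪ ↑Fforced : Set R)) := by
        rw [Ideal.span_le]
        rintro y (hy | ⟨j, hj, rfl⟩)
        · exact Ideal.mem_sup_right (Ideal.subset_span hy)
        · exact ih j (by have := Fin.lt_def.mp hj; omega)
      have := (sup_le_sup_left hle G) (hslave i)
      rwa [← sup_assoc, sup_idem] at this
  -- Step 2: `P ≤ G ⊔ P·P`.
  have hFF : Ideal.span ((↑Ffree ∪ ↑Fforced : Set R)) ≤ G ⊔ P * P := by
    rw [Ideal.span_le]
    rintro y (hy | hy)
    · exact Ideal.mem_sup_left (hfree y hy)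
    · exact hforced y hy
  have hP : P ≤ G ⊔ P * P := by
    rw [hPdef, Ideal.span_le]
    rintro y ((hy | hy) | ⟨i, rfl⟩)
    · exact Ideal.mem_sup_left (hfree y hy)
    · exact hforced y hy
    · have := (sup_le_sup_left hFF G) (hmu (i + 1) i (by omega))
      rwa [← sup_assoc, sup_idem] at this
  -- Step 3: Nakayama.
  have hfg : P.FG :=
    Submodule.fg_span (((Ffree.finite_toSet.union Fforced.finite_toSet)).union (Set.finite_range mu))
  exact ideal_le_of_le_sup_mul_self hfg hjac hP

end Finish

end Summit.MatrixMultiplication.MatrixMultiplication.Theorems.GraphEquations
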